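import Literature.NumberTheory.EllipticCurves.CongruenceNumberLevelBoundAsymptoticProofs
import Literature.NumberTheory.EllipticCurves.ModularDegreeSpectralLevelBoundExplicitProofs
import Literature.NumberTheory.EllipticCurves.CongruenceNumberLevelBoundProofs
import Literature.NumberTheory.EllipticCurves.SzpiroSmallJDenominatorProofs
import Literature.NumberTheory.DiophantineGeometry.FaltingsHeightProofs
import HarnessLib

/-!
# Murty–Pasten 2013, Thm 4.3 (EXPLICIT clause `log m_f ≤ log n_f ≤ (1/5) N log N`) — DISCHARGED,
# and Thm 7.1 / Pasten 2023 Cor 2.1 from modularity and Mazur–Kenku alone (proofs)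

Topic `Literature/NumberTheory/EllipticCurves` (family `abc`, LADDER-ABC A1, the *modular method*;
cell abc-stewartyu, seat lit-abc-pasten g5). Theorems only — NO new statement, NO new named fact
(D-0026). Sources: M. R. Murty, H. Pasten, *Modular forms and effective Diophantine approximation*,
J. Number Theory **133** (2013) 3739–3754 [`MurtyPasten2013`] (version of record held and read:
Thm 3.5 p. 3746, Thms 4.2–4.3 pp. 3747–3748, Thm 7.1 p. 3752); H. Pasten, *Shimura curves and the
abc conjecture*, J. Number Theory **254** (2024) = arXiv:1705.09251v4 [`PastenShimura2024`] (held
TeX read: Prop 5.4, Thm 5.5, §5.6 pp. 17–19; Prop 7.1 and the proof of Thm 7.2 p. 26); H. Pasten,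
*Szpiro's conjecture when the denominator of j is small* (2023), Cor 2.1.

## What this file proves

* `MurtyPasten.log_congruenceNumber_le_holds` — **DISCHARGE** of the named fact
  `MurtyPasten.log_congruenceNumber_le` (`CongruenceNumberLevelBound.lean`): for EVERY level `N`
  and every modular parametrisation datum `D` at level `N`, `log n_f ≤ (1/5) N log N` for the
  congruence number `n_f` of the newform `f = D.f` (Murty–Pasten Thm 4.3, first display, verbatim
  constant `1/5`).
* `MurtyPasten.log_modularDegree_le_holds` — **DISCHARGE** of `MurtyPasten.log_modularDegree_le`
  (Thm 4.3, the modular-degree clause: `log m_f ≤ (1/5) N log N` for the optimal datum).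
* Consequences with the Thm 4.3 hypothesis of the sibling files now a theorem:
  `MurtyPasten.faltingsHeight_lt_of_modularity_mazurKenku` (Thm 7.1, height clause
  `h_F(E) < 0.1 N log N + 11`, the named fact `MurtyPasten.faltingsHeight_lt`) and
  `MurtyPasten.log_minimalDiscriminant_lt_148_of_modularity_mazurKenku` (`log|Δ_E| < 1.2 N log N
  + 148`, the form of the discriminant clause the tree's normalisation supports — see the ERRATUM in
  `CongruenceNumberLevelBound.lean`) from the TWO named facts {modularity with an integral Manin
  constant `nonempty_modularParametrizationData`, Mazur–Kenku `PastenShimura2024_minimalDegree_le_163_mul`};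
  and `Pasten2023_cor_2_1_of_modularity_mazurKenku` (Pasten 2023, Cor 2.1: `h(j_E) ≤ 16 N_E log N_E`,
  the named fact `Pasten2023_cor_2_1`) from the same two facts (previously:
  `Pasten2023_cor_2_1_of_murtyPasten`, modulo `MurtyPasten.faltingsHeight_lt`).

## The proof (a deviation from print, recorded)

Murty–Pasten prove Thm 4.3 through the index `i_N = [𝒪'_N : 𝕋'_N]` of the coprime Hecke algebra in
its normalisation: `n_f ∣ i_N` (Thm 4.2) and `log i_N ≤ (1/5) N log N` (Thm 3.5: Hadamard,
Deligne's bound, Sturm, `dim ≤ (N+4)/12`, a "calculus exercise" for `N > 30` and a Sage TABLE of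
Fourier coefficients for the levels `N ≤ 30`). The tree has no carrier for `𝕋'_N`, but it PROVES
the finer road of Pasten's §5.6 / Thm 5.5, which this file runs with explicit constants:

1. `n_f ∣ ∏_{P ≠ 𝕀_f} η_f(P)` over the minimal primes of `𝕋 = anemicHeckeRing N 2`
   (`ModularParametrizationData.congruenceNumber_dvd_prod_heckeCongruenceModulus`, PROVED), and
   `m_f = δ_{1,N} ∣ ∏_{P ≠ 𝕀_f} η_f(P)` for the optimal datum (`PastenShimura2024_thm_5_5_holds`,
   PROVED via Riemann's period relations); every `η_f(P) ≥ 1`.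
2. `Σ_{P ≠ 𝕀_f} log η_f(P) ≤ (Σ_{P ≠ 𝕀_f} rank_ℤ(𝕋 ⧸ P)) · log(2G)`, `G = N²(1 + log N)/6 + 1`
   (`MurtyPasten.sum_log_heckeCongruenceModulus_le_trivial`: Pasten's Prop 5.4 at a Sturm-bound
   distinguishing prime with the TRIVIAL Hecke bound `|a_p| ≤ p + 1`; PROVED).
3. `Σ_{P ≠ 𝕀_f} rank_ℤ(𝕋 ⧸ P) ≤ (N + 1)/12` (`Pasten2024.sum_erase_finrank_quotient_le_succ_div_twelve`:
   G. Martin's newform count in von Känel–Matschke's form, Atkin–Lehner + genus formula; PROVED) and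
   `N ≥ 11` (`Pasten2024.eleven_le_level`: `S₂(Γ₀(N)) = 0` for `N ≤ 10`).
4. The one new ingredient, `MurtyPasten.trivialBound_le_fifth`:
   `((N + 1)/12) · log(2(N²(1 + log N)/6 + 1)) ≤ (1/5) N log N` for all real `N ≥ 11` — elementary
   (`log 8 = 3 log 2`, `log y ≤ y − 1`, `log y ≤ y/e`, `log 3 ≥ log 2 + 1/3`, Mathlib's decimal
   bounds for `log 2` and `e`); the tightest level is `N = 11` (`4.935 ≤ 5.275`). Because step 3
   counts eigen-systems by `(N + 1)/12` rather than Murty–Pasten's `(N + 4)/12`, NO table of small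
   levels is needed: the inequality holds uniformly from `N = 11` on.

So the printed constant `1/5` is certified for all levels, unconditionally (the datum is given; no
modularity is used for Thm 4.3 itself).

WHAT THIS IS NOT: no claim on `abc`; the explicit `S`-unit/`abc` constants of Murty–Pasten Thms
1.1/1.2 (`4.8 R log R + 13 R + 25`) are NOT derived here (their printed proof needs the conductor
exponent `2⁴` at `2` for Frey curves [Diamond–Kramer], the tree proves `2⁸`; and the errata recorded
in `SUnitAbcBoundsCongruenceNumber.lean` stand); `θ₀ = 1` material, below the REACHED
`EpsShapeBound (2/3)`.

## References

* [MurtyPasten2013] M. R. Murty, H. Pasten, J. Number Theory 133 (2013) 3739–3754: Thm 3.5 (p. 3746,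
  incl. the table for `N ≤ 30`), Thm 4.2, Thm 4.3 (pp. 3747–3748), Thm 7.1 (p. 3752).
* [PastenShimura2024] H. Pasten, J. Number Theory 254 (2024) = arXiv:1705.09251v4: Prop 5.4, Thm 5.5,
  §5.6 (pp. 17–19), Prop 7.1 and proof of Thm 7.2 (p. 26).
* [Pasten2023SzpiroSmallDenominator] H. Pasten, *Szpiro's conjecture when the denominator of j is small*,
  Cor. 2.1.
-/

noncomputable section

open scoped MatrixGroups ModularForm

open WeierstrassCurve CongruenceSubgroup UpperHalfPlane

namespace Literature.NumberTheory.EllipticCurves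

open ModularForms Pasten2024 DiophantineGeometry

namespace MurtyPasten

/-! ### The explicit real inequality -/

/-- **`((x + 1)/12) · log(2(x²(1 + log x)/6 + 1)) ≤ (1/5) x log x` for real `x ≥ 11`** — the
"calculus exercise" of Murty–Pasten's Thm 3.5 (p. 3746: "strictly less than `0.2 N log N` when
`N > 30`"), here for the tree's sharper eigen-system count `(N + 1)/12`, which makes it hold from
`x = 11` on (at `x = 11`: `4.935 ≤ 5.275`). Proof: with `L = log x ≥ 3 log 2` and
`A = x²(1 + L)/3 ≥ 121`, `log(A + 2) ≤ log A + 1/60`, `log A = 2L + log(1 + L) − log 3`,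
`log(1 + L) ≤ (1 + L)/e`, `log 3 ≥ log 2 + 1/3`, `L ≤ 3 log 2 + 3/8 + (x − 11)/11`.
[cite: MurtyPasten2013, Thm 3.5 (proof, p. 3746)] -/
theorem trivialBound_le_fifth_real {x : ℝ} (hx : 11 ≤ x) :
    (x + 1) / 12 * Real.log (2 * (x ^ 2 * (1 + Real.log x) / 6 + 1)) ≤
      1 / 5 * x * Real.log x := by
  have hx0 : 0 < x := by linarith
  set L : ℝ := Real.log x with hL
  have hl2 := Real.log_two_gt_d9
  have hl2' := Real.log_two_lt_d9
  have h8 : Real.log 8 = 3 * Real.log 2 := by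
    rw [show (8 : ℝ) = 2 ^ 3 by norm_num, Real.log_pow]; norm_num
  -- `L ≥ log 8 = 3 log 2`
  have hL8 : 3 * Real.log 2 ≤ L := by
    have : Real.log 8 ≤ L := Real.log_le_log (by norm_num) (by linarith)
    linarith
  have hL2 : 2 ≤ L := by linarith
  -- `L = log 8 + log(11/8) + log(x/11) ≤ 3 log 2 + 3/8 + (x - 11)/11`
  have hL_le : L ≤ 3 * Real.log 2 + 3 / 8 + (x - 11) / 11 := by
    have h1 : Real.log (x / 11) ≤ x / 11 - 1 := Real.log_le_sub_one_of_pos (by positivity)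
    have h2 : Real.log (11 / 8 : ℝ) ≤ 11 / 8 - 1 := Real.log_le_sub_one_of_pos (by norm_num)
    have e1 : L = Real.log (x / 11) + Real.log (11 / 8) + Real.log 8 := by
      rw [hL, Real.log_div hx0.ne' (by norm_num), Real.log_div (by norm_num) (by norm_num)]
      ring
    rw [e1, h8]
    linarith
  -- `log(1 + L) ≤ (1 + L)/e ≤ 0.36788 (1 + L)`
  have he := Real.exp_one_gt_d9
  have hepos : 0 < Real.exp 1 := Real.exp_pos 1
  have h1L : 0 < 1 + L := by linarith
  have hlog1L : Real.log (1 + L) ≤ (1 + L) / Real.exp 1 := by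
    have h := Real.log_le_sub_one_of_pos (show 0 < (1 + L) / Real.exp 1 by positivity)
    rw [Real.log_div h1L.ne' hepos.ne', Real.log_exp] at h
    linarith
  have hinv : (1 + L) / Real.exp 1 ≤ 0.36788 * (1 + L) := by
    rw [div_le_iff₀ hepos]
    nlinarith
  -- `log 3 ≥ log 2 + 1/3`
  have hlog3 : Real.log 2 + 1 / 3 ≤ Real.log 3 := by
    have h := Real.one_sub_inv_le_log_of_pos (show (0 : ℝ) < 3 / 2 by norm_num)
    have e : Real.log 3 = Real.log (3 / 2) + Real.log 2 := by
      rw [Real.log_div (by norm_num) (by norm_num)]; ring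
    rw [e]
    norm_num at h ⊢
    linarith
  -- `A = x²(1 + L)/3 ≥ 121`, `2G = A + 2`
  set A : ℝ := x ^ 2 * (1 + L) / 3 with hA
  have hx2 : 121 ≤ x ^ 2 := by nlinarith
  have hA121 : 121 ≤ A := by
    have h3 : 3 ≤ 1 + L := by linarith
    have : 121 * 3 ≤ x ^ 2 * (1 + L) := by nlinarith
    rw [hA]; linarith
  have hApos : 0 < A := by linarith
  have h2G : 2 * (x ^ 2 * (1 + L) / 6 + 1) = A + 2 := by rw [hA]; ring
  -- `log(A + 2) ≤ log A + 1/60`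
  have hlog2G : Real.log (A + 2) ≤ Real.log A + 1 / 60 := by
    have h1 : Real.log (A + 2) ≤ Real.log (A * (61 / 60)) :=
      Real.log_le_log (by linarith) (by linarith)
    have h2 : Real.log (A * (61 / 60)) = Real.log A + Real.log (61 / 60) :=
      Real.log_mul hApos.ne' (by norm_num)
    have h3 : Real.log (61 / 60 : ℝ) ≤ 61 / 60 - 1 := Real.log_le_sub_one_of_pos (by norm_num)
    linarith
  -- `log A = 2L + log(1 + L) - log 3`
  have hlogA : Real.log A = 2 * L + Real.log (1 + L) - Real.log 3 := by
    rw [hA, Real.log_div (by positivity) (by norm_num), Real.log_mul (by positivity) h1L.ne',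
      Real.log_pow]
    push_cast; ring
  -- the size bound `log(2G) ≤ 2.36788 L - 0.64193`
  have hB : Real.log (A + 2) ≤ 2.36788 * L - 0.64193 := by
    have : Real.log (A + 2) ≤ 2 * L + 0.36788 * (1 + L) - (Real.log 2 + 1 / 3) + 1 / 60 := by
      linarith
    linarith
  rw [h2G]
  have hfac : 0 ≤ (x + 1) / 12 := by positivity
  have hstep : (x + 1) / 12 * Real.log (A + 2) ≤ (x + 1) / 12 * (2.36788 * L - 0.64193) :=
    mul_le_mul_of_nonneg_left hB hfac
  -- the final linear form in the atoms `x·L`, `x`, `L`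
  have hxL : 3 * Real.log 2 * x ≤ L * x := mul_le_mul_of_nonneg_right hL8 hx0.le
  have hfinal : (x + 1) / 12 * (2.36788 * L - 0.64193) ≤ 1 / 5 * x * L := by
    nlinarith [hxL, hL_le, hx, hl2, hl2']
  linarith

/-- The same at natural levels `N ≥ 11`, in the shape of the tree's size bound
`sum_log_heckeCongruenceModulus_le_trivial`: `((N + 1)/12) · log(2(N²(1 + log N)/6 + 1)) ≤ (1/5) N log N`.
[cite: MurtyPasten2013, Thm 3.5 (proof, p. 3746)] -/
theorem trivialBound_le_fifth {N : ℕ} (hN : 11 ≤ N) :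
    ((N : ℝ) + 1) / 12 * Real.log (2 * ((N : ℝ) ^ 2 * (1 + Real.log N) / 6 + 1)) ≤
      (1 / 5 : ℝ) * N * Real.log N :=
  trivialBound_le_fifth_real (by exact_mod_cast hN)

/-! ### `Σ_{P ≠ 𝕀_f} log η_f(P) ≤ (1/5) N log N` at every level -/

variable {N : ℕ} [NeZero N] {W : WeierstrassCurve ℚ} [W.IsElliptic]

/-- **`Σ_{P ≠ 𝕀_f} log η_f(P) ≤ (1/5) N log N`** for every modular parametrisation datum at any level
`N`: the trivial-Hecke-bound size estimate (`sum_log_heckeCongruenceModulus_le_trivial`), the count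
`Σ_{P ≠ 𝕀_f} #c ≤ (N + 1)/12` (`Pasten2024.sum_erase_finrank_quotient_le_succ_div_twelve`),
`N ≥ 11` (`Pasten2024.eleven_le_level`) and `trivialBound_le_fifth`. This is Murty–Pasten's
`log i_N ≤ (1/5) N log N` (Thm 3.5) in the tree's currency `∏_{P ≠ 𝕀_f} η_f(P)` (Pasten Thm 5.5),
which both `n_f` and `m_f` divide.
[cite: MurtyPasten2013, Thm 3.5 (p. 3746)] [cite: PastenShimura2024, Prop. 5.4, Prop. 7.1 and proof of Thm. 7.2 (p. 26)] -/
theorem sum_log_heckeCongruenceModulus_le_fifth (D : ModularParametrizationData W N) :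
    ∑ P ∈ (finite_minimalPrimes_anemicHeckeRing N 2).toFinset.erase (eigenIdeal D.f),
        Real.log (heckeCongruenceModulus D.f P : ℝ) ≤ (1 / 5 : ℝ) * N * Real.log N := by
  have h11 : 11 ≤ N := eleven_le_level D
  have hsize := sum_log_heckeCongruenceModulus_le_trivial D
  have hcount := Pasten2024.sum_erase_finrank_quotient_le_succ_div_twelve D
  have hG0 : 0 ≤ Real.log (2 * ((N : ℝ) ^ 2 * (1 + Real.log N) / 6 + 1)) := by
    apply Real.log_nonneg
    have : 0 ≤ (N : ℝ) ^ 2 * (1 + Real.log N) / 6 := by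
      have h1 : (1 : ℝ) ≤ N := by exact_mod_cast (show 1 ≤ N by omega)
      have := Real.log_nonneg h1
      positivity
    linarith
  calc ∑ P ∈ (finite_minimalPrimes_anemicHeckeRing N 2).toFinset.erase (eigenIdeal D.f),
        Real.log (heckeCongruenceModulus D.f P : ℝ)
      ≤ (∑ P ∈ (finite_minimalPrimes_anemicHeckeRing N 2).toFinset.erase (eigenIdeal D.f),
          (Module.finrank ℤ (anemicHeckeRing N 2 ⧸ P) : ℝ)) *
        Real.log (2 * ((N : ℝ) ^ 2 * (1 + Real.log N) / 6 + 1)) := hsize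
    _ ≤ ((N : ℝ) + 1) / 12 * Real.log (2 * ((N : ℝ) ^ 2 * (1 + Real.log N) / 6 + 1)) :=
        mul_le_mul_of_nonneg_right hcount hG0
    _ ≤ (1 / 5 : ℝ) * N * Real.log N := trivialBound_le_fifth h11

omit [W.IsElliptic] in
/-- **`log x ≤ Σ_{P ≠ 𝕀_f} log η_f(P)` whenever `x ∣ ∏_{P ≠ 𝕀_f} η_f(P)`** (each factor is a
positive integer, `ModularParametrizationData.heckeCongruenceModulus_ne_zero`; the junk case
`x = 0` holds because every `log η_f(P) ≥ 0`). [cite: PastenShimura2024, §5.4 p. 17 (η ≥ 1)] -/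
theorem log_le_sum_log_heckeCongruenceModulus_of_dvd (D : ModularParametrizationData W N) {x : ℕ}
    (hx : x ∣ ∏ P ∈ (finite_minimalPrimes_anemicHeckeRing N 2).toFinset.erase (eigenIdeal D.f),
      heckeCongruenceModulus D.f P) :
    Real.log (x : ℝ) ≤ ∑ P ∈ (finite_minimalPrimes_anemicHeckeRing N 2).toFinset.erase
      (eigenIdeal D.f), Real.log (heckeCongruenceModulus D.f P : ℝ) := by
  have hne : ∀ P ∈ (finite_minimalPrimes_anemicHeckeRing N 2).toFinset.erase (eigenIdeal D.f),
      (heckeCongruenceModulus D.f P : ℝ) ≠ 0 := fun P hP => by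
    exact_mod_cast D.heckeCongruenceModulus_ne_zero
      ((finite_minimalPrimes_anemicHeckeRing N 2).mem_toFinset.mp (Finset.mem_of_mem_erase hP))
      (Finset.ne_of_mem_erase hP)
  have hlog0 : ∀ P ∈ (finite_minimalPrimes_anemicHeckeRing N 2).toFinset.erase (eigenIdeal D.f),
      0 ≤ Real.log (heckeCongruenceModulus D.f P : ℝ) := fun P hP => by
    apply Real.log_nonneg
    have h1 : heckeCongruenceModulus D.f P ≠ 0 := by exact_mod_cast hne P hP
    exact_mod_cast Nat.one_le_iff_ne_zero.mpr h1
  have hsum0 : 0 ≤ ∑ P ∈ (finite_minimalPrimes_anemicHeckeRing N 2).toFinset.erase (eigenIdeal D.f),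
      Real.log (heckeCongruenceModulus D.f P : ℝ) := Finset.sum_nonneg hlog0
  rcases Nat.eq_zero_or_pos x with h0 | hxpos
  · rw [h0, Nat.cast_zero, Real.log_zero]; exact hsum0
  have hle : x ≤ ∏ P ∈ (finite_minimalPrimes_anemicHeckeRing N 2).toFinset.erase (eigenIdeal D.f),
      heckeCongruenceModulus D.f P := Nat.le_of_dvd D.prod_heckeCongruenceModulus_pos hx
  have hle' : (x : ℝ) ≤ ∏ P ∈ (finite_minimalPrimes_anemicHeckeRing N 2).toFinset.erase
      (eigenIdeal D.f), (heckeCongruenceModulus D.f P : ℝ) := by exact_mod_cast hle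
  have hx' : (0 : ℝ) < x := by exact_mod_cast hxpos
  calc Real.log (x : ℝ) ≤ Real.log (∏ P ∈ (finite_minimalPrimes_anemicHeckeRing N 2).toFinset.erase
        (eigenIdeal D.f), (heckeCongruenceModulus D.f P : ℝ)) := Real.log_le_log hx' hle'
    _ = _ := Real.log_prod hne

/-! ### Murty–Pasten 2013, Thm 4.3 (explicit clause): DISCHARGED -/

/-- **Murty–Pasten 2013, Theorem 4.3, `log n_f ≤ (1/5) N log N` — DISCHARGED.** For every modular
parametrisation datum `D` at any level `N`, the congruence number `n_f` of its newform satisfies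
`log n_f ≤ (1/5) N log N`. Proof over the tree (deviation from the printed Thm 3.5 / Thm 4.2 road
through `i_N`, recorded in the module docstring): `n_f ∣ ∏_{P ≠ 𝕀_f} η_f(P)`
(`congruenceNumber_dvd_prod_heckeCongruenceModulus`) and `sum_log_heckeCongruenceModulus_le_fifth`.
Unconditional; no table of small levels.
[cite: MurtyPasten2013, Thm 4.3 (p. 3748, first display) with Thm 3.5 and Thm 4.2] [cite: PastenShimura2024, §5.6 (p. 19)] -/
theorem log_congruenceNumber_le_holds : log_congruenceNumber_le := fun _W _ _N _ D =>
  (log_le_sum_log_heckeCongruenceModulus_of_dvd D D.congruenceNumber_dvd_prod_heckeCongruenceModulus).trans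
    (sum_log_heckeCongruenceModulus_le_fifth D)

/-- **Murty–Pasten 2013, Theorem 4.3, `log m_f ≤ (1/5) N log N` — DISCHARGED.** For every datum `D`
at level `N` of minimal degree among the data with the same newform (the optimal quotient), the
modular degree satisfies `log m_f ≤ (1/5) N log N`. Printed: `m_f ∣ n_f` (Ribet, Thm 4.1) and the
previous theorem; over the tree: `m_f = δ_{1,N} ∣ ∏_{P ≠ 𝕀_f} η_f(P)` (Pasten's Thm 5.5,
`PastenShimura2024_thm_5_5_holds`, PROVED) and `sum_log_heckeCongruenceModulus_le_fifth`.
[cite: MurtyPasten2013, Thm 4.3 (p. 3748, first display) with Thm 4.1] [cite: PastenShimura2024, Thm. 5.5] -/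
theorem log_modularDegree_le_holds : log_modularDegree_le := fun W _ N _ D hmin =>
  (log_le_sum_log_heckeCongruenceModulus_of_dvd D (PastenShimura2024_thm_5_5_holds N W D hmin)).trans
    (sum_log_heckeCongruenceModulus_le_fifth D)

/-! ### Thm 7.1 from modularity and Mazur–Kenku alone -/

/-- **Murty–Pasten 2013, Thm 7.1, height clause `h_F(E) < 0.1 N log N + 11`, from TWO named facts**:
modularity with an integral Manin constant (`nonempty_modularParametrizationData`) and Mazur–Kenku
(`PastenShimura2024_minimalDegree_le_163_mul`) — the sibling's
`faltingsHeight_lt_of_modularity_of_log_modularDegree_le` (MP §§5–7 over the tree: Zagier's identity,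
the trivial Petersson bound, global minimal models) with its Thm 4.3 hypothesis DISCHARGED by
`log_modularDegree_le_holds`. [cite: MurtyPasten2013, Thm 7.1 (p. 3752) and its proof] -/
theorem faltingsHeight_lt_of_modularity_mazurKenku (hmod : nonempty_modularParametrizationData)
    (h163 : PastenShimura2024_minimalDegree_le_163_mul) : faltingsHeight_lt :=
  faltingsHeight_lt_of_modularity_of_log_modularDegree_le hmod h163 log_modularDegree_le_holds

/-- **Murty–Pasten 2013, Thm 7.1, discriminant clause in the tree's normalisation,
`log|Δ_E| < 1.2 N log N + 148`, from the same two named facts** (the sibling's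
`log_minimalDiscriminant_lt_148_of_faltingsHeight_lt` with the height clause above and the DISCHARGED
`log|Δ_min| < 12 h + 16`, `WeierstrassCurve.log_minimalDiscriminantNorm_lt_faltingsHeight_holds`). The
printed `+ 93` inherits a normalisation slip (ERRATUM in `CongruenceNumberLevelBound.lean`) and is
not asserted. [cite: MurtyPasten2013, Thm 7.1 (p. 3752), discriminant clause] [cite: PastenShimura2024, §3 (3.1), p. 13] -/
theorem log_minimalDiscriminant_lt_148_of_modularity_mazurKenku
    (hmod : nonempty_modularParametrizationData) (h163 : PastenShimura2024_minimalDegree_le_163_mul)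
    (W : WeierstrassCurve ℚ) [W.IsElliptic] :
    Real.log (W.minimalDiscriminantNorm ℤ) <
      1.2 * (W.conductorNorm ℤ : ℝ) * Real.log (W.conductorNorm ℤ) + 148 :=
  log_minimalDiscriminant_lt_148_of_faltingsHeight_lt (faltingsHeight_lt_of_modularity_mazurKenku hmod h163)
    WeierstrassCurve.log_minimalDiscriminantNorm_lt_faltingsHeight_holds W

end MurtyPasten

/-! ### Pasten 2023, Cor 2.1 from modularity and Mazur–Kenku alone -/

/-- **Pasten 2023, Cor 2.1 (`h(j_E) ≤ 16 N_E log N_E` for all `E/ℚ`) from TWO named facts**: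
modularity (`nonempty_modularParametrizationData`) and Mazur–Kenku
(`PastenShimura2024_minimalDegree_le_163_mul`) — the sibling's `Pasten2023_cor_2_1_of_murtyPasten`
(Silverman's explicit `h(j) ≤ 12 h_F + 6 log(1 + h(j)) + 37`, stable vs. unstable Faltings height
over `ℚ`) with its Murty–Pasten Thm 7.1 hypothesis replaced by
`MurtyPasten.faltingsHeight_lt_of_modularity_mazurKenku`.
[cite: Pasten2023SzpiroSmallDenominator, Cor. 2.1] [cite: MurtyPasten2013, Thm 7.1] -/
theorem Pasten2023_cor_2_1_of_modularity_mazurKenku (hmod : nonempty_modularParametrizationData)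
    (h163 : PastenShimura2024_minimalDegree_le_163_mul) : Pasten2023_cor_2_1 :=
  Pasten2023_cor_2_1_of_murtyPasten (MurtyPasten.faltingsHeight_lt_of_modularity_mazurKenku hmod h163)
    hmod

/-- **Pasten 2023, Thm 1.2 (the Main Result: `den(j_E) ≤ A (log num(j_E))^B` ⇒
`Δ_E ≤ A · 16^{B+1} · N_E^{B+5} · (log N_E)^B`) from modularity, Mazur–Kenku and Cor 3.4** (PROVED
composition; appended, the statements above unchanged): the printed §4 proof `Pasten2023_thm_1_2_of_cor`
with its Cor 2.1 input replaced by `Pasten2023_cor_2_1_of_modularity_mazurKenku`; the local input Cor 3.4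
(`Δ_E ∣ 16 · den(j_E) · N_E⁵`, Tate's algorithm with Pesenti–Szpiro and Lorenzini) remains the named
fact `Pasten2023_cor_3_4`. [cite: Pasten2023SzpiroSmallDenominator, Thm. 1.2 (proof, §4)] -/
theorem Pasten2023_thm_1_2_of_modularity_mazurKenku_of_cor_3_4
    (hmod : nonempty_modularParametrizationData) (h163 : PastenShimura2024_minimalDegree_le_163_mul)
    (h34 : Pasten2023_cor_3_4) : Pasten2023_thm_1_2 :=
  Pasten2023_thm_1_2_of_cor (Pasten2023_cor_2_1_of_modularity_mazurKenku hmod h163) h34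

end Literature.NumberTheory.EllipticCurves

end
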